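import Literature.GroupTheory.FiniteAbelian.AlternatingPairing
import HarnessLib

/-!
# Isogeny pairs at finite level: `dim ker f + dim ker g` is even

Pure finite group theory, stated and proved in general: the finite-level core of Cassels' parity
formula for an isogeny `φ : E → E'` of elliptic curves and its dual (Cassels 1965, via the
Cassels–Tate pairing on `Ш`, which is alternating, nondegenerate modulo divisible elements, and
makes `φ` and its dual adjoint; Milne, *Arithmetic Duality Theorems*, Ch. I §6).

Let `T`, `T'` be finite abelian `p`-groups carrying bi-additive pairings `b : T × T → Q`,
`b' : T' × T' → Q` which are alternating (`b(x, x) = 0`) and nondegenerate, where the `p`-torsion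
`Q[p]` embeds in `𝔽_p` (as for `Q = ℚ/ℤ`), and let `f : T → T'`, `g : T' → T` be homomorphisms
with `g ∘ f = p`, `f ∘ g = p` which are adjoint: `b'(f x, y) = b(x, g y)`. Then

* `exists_natCard_eq_pow_two_mul`: **`#T = p^{2i}` is a square** (induction on `#T`:
  `#T = #(T/T[p]) · #T[p]`, `#T[p] = p^{2k}` by the even `p`-rank
  `exists_natCard_torsionBy_eq_pow_two_mul`, and `T/T[p]` is again such a group,
  `exists_quotTorsionPairing`, of smaller order unless `T[p] = 0`, i.e. `T = 0`; the
  `ℚ/ℤ`-valued case is also `Literature.Algebra.Module.exists_natCard_eq_pow_two_mul`);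
* `natCard_ker_mul_card_le`: **the counting inequality `#ker f · #T' ≤ #T · #ker g`**: `ker f` and
  `T / g(T')` are killed by `p`, and `x ↦ ι ∘ b(x, ·)` is an injective `𝔽_p`-linear map from
  `ker f` to the dual of `T / g(T')` (it is well defined because `b(x, g y) = b'(f x, y) = 0`, and
  injective because `b` is nondegenerate), so `#ker f ≤ #(T / g(T')) = #T · #ker g / #T'`;
* `exists_natCard_ker_eq_pow_and_even_of_adjoint`: **`#ker f = p^m`, `#ker g = p^n` with
  `m + n` even**: the counting inequality and its mirror image (the adjointness the other way
  round, `b(g y, x) = b'(y, f x)`, follows from the antisymmetry of alternating pairings) give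
  `#ker f · #T' = #T · #ker g`, i.e. `m + 2 i' = 2 i + n`.

## Design

As in `Literature.GroupTheory.FiniteAbelian.AlternatingPairing`: `T[n]` is Mathlib's
`AddSubgroup.torsionBy` (scoped notation), pairings are curried additive homomorphisms
`T →+ T →+ Q`, nondegeneracy is stated on the left, "`p`-group" is the elementwise condition
`∀ t, ∃ n, p ^ n • t = 0`, and the `𝔽_p`-vector space structures (`AddCommGroup.zmodModule`,
`QuotientAddGroup.zmodModule`) are introduced inside the proofs only, as opaque local instances
(`haveI`: only their existence is used, never the definition of `•`). Everything is a `theorem`;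
no number theory is imported. What is NOT here: the passage from `Ш[p^∞]` (cofinitely generated,
with divisible part) to its finite quotients, and anything arithmetic.

## References

* J. W. S. Cassels, *Arithmetic on curves of genus 1. VIII: On conjectures of Birch and
  Swinnerton-Dyer*, J. reine angew. Math. 217 (1965), 180–199 (`Cassels1965ArithmeticVIII`).
* J. S. Milne, *Arithmetic Duality Theorems*, 2nd ed. (2006), Ch. I §6 (`MilneADT2006`).
-/

noncomputable section

open Module LinearMap
open scoped AddSubgroup

namespace Literature.GroupTheory.FiniteAbelian

universe u v

section PPrimary

variable (p : ℕ)

/-- A `p`-primary abelian group (`∀ t, ∃ n, p ^ n • t = 0`) with trivial `p`-torsion is trivial: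
if `p ^ (n + 1) • t = 0` then `p ^ n • t ∈ T[p] = 0`. [folklore] -/
theorem eq_zero_of_torsionBy_eq_bot {T : Type u} [AddCommGroup T]
    (hT : ∀ t : T, ∃ n : ℕ, p ^ n • t = 0) (hbot : T[(p : ℤ)] = ⊥) (t : T) : t = 0 := by
  obtain ⟨n, hn⟩ := hT t
  induction n generalizing t with
  | zero => rwa [pow_zero, one_smul] at hn
  | succ n ih =>
    apply ih
    have hmem : p ^ n • t ∈ T[(p : ℤ)] := by
      rw [AddSubgroup.torsionBy.nsmul_iff, smul_smul, ← pow_succ', hn]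
    rwa [hbot, AddSubgroup.mem_bot] at hmem

/-- A quotient of a `p`-primary abelian group is `p`-primary. [folklore] -/
theorem exists_pow_smul_eq_zero_quotient {T : Type u} [AddCommGroup T]
    (hT : ∀ t : T, ∃ n : ℕ, p ^ n • t = 0) (H : AddSubgroup T) (z : T ⧸ H) :
    ∃ n : ℕ, p ^ n • z = 0 := by
  induction z using QuotientAddGroup.induction_on with
  | H t =>
    obtain ⟨n, hn⟩ := hT t
    exact ⟨n, by rw [← QuotientAddGroup.mk_nsmul, hn, QuotientAddGroup.mk_zero]⟩

variable [hp : Fact p.Prime]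

/-- **Square order.** A finite abelian `p`-group `T` with a bi-additive pairing `B : T × T → Q`
which is alternating (`B(x, x) = 0`) and nondegenerate, where `Q[p]` embeds in `𝔽_p` (`ι`), has
order `#T = p^{2i}`. Induction on `#T`: `#T = #(T/T[p]) · #T[p]` with `#T[p] = p^{2k}`
(`exists_natCard_torsionBy_eq_pow_two_mul`), and `T/T[p]` carries the nondegenerate alternating
pairing `B(pa, b)` (`exists_quotTorsionPairing`) and has smaller order unless `T[p] = 0`, in which
case `T = 0` (`eq_zero_of_torsionBy_eq_bot`). (Classically: `T ≅ M × M`.) The `ℚ/ℤ`-valued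
special case, by symplectic reduction instead, is
`Literature.Algebra.Module.exists_natCard_eq_pow_two_mul`. [folklore] -/
theorem exists_natCard_eq_pow_two_mul {Q : Type v} [AddCommGroup Q] (ι : Q[(p : ℤ)] →+ ZMod p)
    (hι : Function.Injective ι) (T : Type u) [AddCommGroup T] [Finite T]
    (hT : ∀ t : T, ∃ n : ℕ, p ^ n • t = 0) (B : T →+ T →+ Q) (halt : ∀ x, B x x = 0)
    (hnd : ∀ x, (∀ y, B x y = 0) → x = 0) : ∃ i : ℕ, Nat.card T = p ^ (2 * i) := by
  suffices key : ∀ (n : ℕ) (T : Type u) [AddCommGroup T] [Finite T] (B : T →+ T →+ Q),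
      (∀ t : T, ∃ n : ℕ, p ^ n • t = 0) → (∀ x, B x x = 0) → (∀ x, (∀ y, B x y = 0) → x = 0) →
      Nat.card T = n → ∃ i : ℕ, Nat.card T = p ^ (2 * i) from key _ T B hT halt hnd rfl
  intro n
  induction n using Nat.strong_induction_on with
  | _ n ih =>
  intro T _ _ B hT halt hnd hn
  by_cases hbot : T[(p : ℤ)] = ⊥
  · -- `T[p] = 0` forces `T = 0`
    haveI : Subsingleton T := ⟨fun a b ↦ by
      rw [eq_zero_of_torsionBy_eq_bot p hT hbot a, eq_zero_of_torsionBy_eq_bot p hT hbot b]⟩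
    exact ⟨0, by rw [Nat.card_of_subsingleton (0 : T), mul_zero, pow_zero]⟩
  -- pass to `T / T[p]`, of smaller order
  have hlt : Nat.card (T ⧸ T[(p : ℤ)]) < n := by
    rw [← hn, AddSubgroup.card_eq_card_quotient_mul_card_addSubgroup (T[(p : ℤ)])]
    have h1 : 1 < Nat.card T[(p : ℤ)] := (AddSubgroup.one_lt_card_iff_ne_bot _).mpr hbot
    have h2 : 0 < Nat.card (T ⧸ T[(p : ℤ)]) := Nat.card_pos
    nlinarith
  obtain ⟨B', hB'alt, hB'nd⟩ := exists_quotTorsionPairing p B halt hnd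
  obtain ⟨i', hi'⟩ := ih _ hlt (T ⧸ T[(p : ℤ)]) B'
    (exists_pow_smul_eq_zero_quotient p hT _) hB'alt hB'nd rfl
  obtain ⟨k, hk⟩ := exists_natCard_torsionBy_eq_pow_two_mul p ι hι T B halt hnd
  refine ⟨i' + k, ?_⟩
  rw [AddSubgroup.card_eq_card_quotient_mul_card_addSubgroup (T[(p : ℤ)]), hi', hk, ← pow_add,
    mul_add]

/-- **The counting inequality `#ker f · #T' ≤ #T · #ker g`.** Let `T`, `T'` be finite abelian
groups, `b : T × T → Q` a bi-additive pairing with trivial left kernel whose `p`-torsion values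
embed in `𝔽_p` (`ι`), and `f : T → T'`, `g : T' → T` homomorphisms with `g ∘ f = p` such that
`b(x, g y) = 0` whenever `f x = 0` (e.g. `b(x, g y) = b'(f x, y)` for a pairing `b'` on `T'`).
Then `ker f ⊆ T[p]` and `T / g(T')` are killed by `p`, and `x ↦ ι ∘ b(x, ·)` is an injective
`𝔽_p`-linear map `ker f → (T / g(T'))^*`; hence `#ker f ≤ #(T / g(T'))`, and
`#T = #(T / g(T')) · #g(T')`, `#T' = #g(T') · #ker g`. [folklore] -/
theorem natCard_ker_mul_card_le {T T' : Type u} {Q : Type v} [AddCommGroup T] [AddCommGroup T']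
    [AddCommGroup Q] [Finite T] [Finite T'] (ι : Q[(p : ℤ)] →+ ZMod p)
    (hι : Function.Injective ι) (b : T →+ T →+ Q) (hbnd : ∀ x, (∀ y, b x y = 0) → x = 0)
    (f : T →+ T') (g : T' →+ T) (hgf : ∀ x, g (f x) = p • x)
    (hfg0 : ∀ x, f x = 0 → ∀ y, b x (g y) = 0) :
    Nat.card f.ker * Nat.card T' ≤ Nat.card T * Nat.card g.ker := by
  -- `ker f ⊆ T[p]` and `pT ⊆ R = g(T')`: two `𝔽_p`-vector spaces
  have hkerp : ∀ x ∈ f.ker, x ∈ T[(p : ℤ)] := fun x hx ↦ by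
    rw [AddSubgroup.torsionBy.nsmul_iff, ← hgf, AddMonoidHom.mem_ker.mp hx, map_zero]
  set R : AddSubgroup T := g.range with hR
  have hRp : ∀ x : T, p • x ∈ R := fun x ↦ ⟨f x, hgf x⟩
  haveI mK : Module (ZMod p) f.ker := AddCommGroup.zmodModule fun x ↦ Subtype.ext (by
    rw [AddSubgroup.coe_nsmul, AddSubgroup.coe_zero]
    exact AddSubgroup.torsionBy.nsmul_iff.mp (hkerp x x.2))
  haveI mR : Module (ZMod p) (T ⧸ R) := QuotientAddGroup.zmodModule hRp
  haveI : Finite (T ⧸ R) := Finite.of_surjective _ QuotientAddGroup.mk_surjective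
  haveI : Module.Finite (ZMod p) (T ⧸ R) := Module.Finite.of_finite
  haveI : Module.Finite (ZMod p) f.ker := Module.Finite.of_finite
  -- `x ↦ b(x, ·)` on `ker f`, with values in `Q[p]`, composed with `ι`
  let tK : f.ker →+ T →+ Q[(p : ℤ)] :=
    { toFun := fun x ↦ (b (x : T)).codRestrict (Q[(p : ℤ)])
        (apply_mem_torsionBy b p (hkerp x x.2))
      map_zero' := by ext; simp
      map_add' := fun x y ↦ by ext; simp }
  have htK : ∀ (x : f.ker) (t : T), ((tK x t : Q[(p : ℤ)]) : Q) = b x t := fun _ _ ↦ rfl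
  let b₁ : f.ker →+ T →+ ZMod p := (AddMonoidHom.compHom ι).comp tK
  have hb₁ : ∀ (x : f.ker) (t : T), b₁ x t = ι (tK x t) := fun _ _ ↦ rfl
  -- it kills `R = g(T')` in `t`, and descends to `ker f → (T / R)^*`
  have hkill : ∀ x : f.ker, R ≤ (b₁ x).ker := by
    rintro x _ ⟨y, rfl⟩
    have h0 : tK x (g y) = 0 := Subtype.ext (by
      rw [htK, ZeroMemClass.coe_zero]
      exact hfg0 x (AddMonoidHom.mem_ker.mp x.2) y)
    rw [AddMonoidHom.mem_ker, hb₁, h0, map_zero]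
  let b₀ : f.ker →+ (T ⧸ R →+ ZMod p) :=
    { toFun := fun x ↦ QuotientAddGroup.lift R (b₁ x) (hkill x)
      map_zero' := QuotientAddGroup.addMonoidHom_ext R (by
        ext t
        change b₁ 0 t = 0
        rw [map_zero, AddMonoidHom.zero_apply])
      map_add' := fun x y ↦ QuotientAddGroup.addMonoidHom_ext R (by
        ext t
        change b₁ (x + y) t = b₁ x t + b₁ y t
        rw [map_add, AddMonoidHom.add_apply]) }
  let β : f.ker →ₗ[ZMod p] Module.Dual (ZMod p) (T ⧸ R) :=
    ((AddMonoidHom.toZModLinearMapEquiv p).toAddMonoidHom.comp b₀).toZModLinearMap p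
  have hβ : ∀ (x : f.ker) (t : T), β x (QuotientAddGroup.mk t) = ι (tK x t) := fun x t ↦ rfl
  -- `β` is injective since `b` is nondegenerate
  have hinj : Function.Injective β := by
    rw [injective_iff_map_eq_zero]
    intro x hx
    have hx0 : (x : T) = 0 := hbnd _ fun t ↦ by
      have h1 : β x (QuotientAddGroup.mk t) = 0 := by rw [hx, LinearMap.zero_apply]
      rw [hβ] at h1
      rw [← htK, hι (h1.trans ι.map_zero.symm), ZeroMemClass.coe_zero]
    exact Subtype.ext hx0
  -- compare dimensions, then cardinalities
  have hfin : finrank (ZMod p) f.ker ≤ finrank (ZMod p) (T ⧸ R) := by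
    have h := LinearMap.finrank_le_finrank_of_injective hinj
    rwa [Subspace.dual_finrank_eq] at h
  have hcard : Nat.card f.ker ≤ Nat.card (T ⧸ R) := by
    rw [← pow_finrank_eq_natCard p f.ker, ← pow_finrank_eq_natCard p (T ⧸ R)]
    exact Nat.pow_le_pow_right hp.out.pos hfin
  have hT : Nat.card T = Nat.card (T ⧸ R) * Nat.card R :=
    AddSubgroup.card_eq_card_quotient_mul_card_addSubgroup R
  have hT' : Nat.card T' = Nat.card R * Nat.card g.ker := by
    rw [AddSubgroup.card_eq_card_quotient_mul_card_addSubgroup g.ker,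
      Nat.card_congr (QuotientAddGroup.quotientKerEquivRange g).toEquiv]
  rw [hT, hT']
  simpa only [mul_assoc] using Nat.mul_le_mul_right (Nat.card R * Nat.card g.ker) hcard

end PPrimary

/-- **Isogeny-pair parity at finite level.** Let `T`, `T'` be finite abelian `p`-groups with
bi-additive pairings `b : T × T → Q`, `b' : T' × T' → Q` which are alternating (`b(x, x) = 0`,
`b'(y, y) = 0`) and nondegenerate, where `Q[p]` embeds in `𝔽_p` (`ι`), and let `f : T → T'`,
`g : T' → T` be homomorphisms with `g ∘ f = p`, `f ∘ g = p` which are adjoint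
(`b'(f x, y) = b(x, g y)`). Then `#ker f = p^m` and `#ker g = p^n` with `m + n` even. Indeed
`#T = p^{2i}`, `#T' = p^{2i'}` (`exists_natCard_eq_pow_two_mul`), both kernels are killed by `p`,
and the counting inequality `natCard_ker_mul_card_le` applied to `(f, g)` and to `(g, f)` (using
`b(g y, x) = b'(y, f x)`, from adjointness and antisymmetry, `eq_neg_of_alternating`) gives
`#ker f · #T' = #T · #ker g`, i.e. `m + 2i' = 2i + n`. This is the finite-level shadow of
Cassels' formula `Ш(E)[φ] · Ш(E')[φ^] ≡ square` for an isogeny and its dual under the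
Cassels–Tate pairing (Cassels 1965; Milne, *Arithmetic Duality Theorems*, I §6). [folklore] -/
theorem exists_natCard_ker_eq_pow_and_even_of_adjoint
    {T T' : Type u} {Q : Type v} [AddCommGroup T] [AddCommGroup T'] [AddCommGroup Q]
    [Finite T] [Finite T'] (p : ℕ) [Fact p.Prime]
    (hT : ∀ t : T, ∃ n : ℕ, p ^ n • t = 0) (hT' : ∀ t : T', ∃ n : ℕ, p ^ n • t = 0)
    (ι : Q[(p : ℤ)] →+ ZMod p) (hι : Function.Injective ι)
    (b : T →+ T →+ Q) (b' : T' →+ T' →+ Q)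
    (hb : ∀ x, b x x = 0) (hb' : ∀ y, b' y y = 0)
    (hbnd : ∀ x, (∀ y, b x y = 0) → x = 0) (hb'nd : ∀ x, (∀ y, b' x y = 0) → x = 0)
    (f : T →+ T') (g : T' →+ T)
    (hgf : ∀ x, g (f x) = p • x) (hfg : ∀ y, f (g y) = p • y)
    (hadj : ∀ x y, b' (f x) y = b x (g y)) :
    ∃ m n : ℕ, Nat.card f.ker = p ^ m ∧ Nat.card g.ker = p ^ n ∧ Even (m + n) := by
  have hp : p.Prime := Fact.out
  -- adjointness the other way round, from antisymmetry
  have hadj' : ∀ y x, b (g y) x = b' y (f x) := fun y x ↦ by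
    rw [eq_neg_of_alternating b hb (g y) x, ← hadj x y, eq_neg_of_alternating b' hb' (f x) y,
      neg_neg]
  -- both kernels are killed by `p`, hence are `𝔽_p`-vector spaces of orders `p^m`, `p^n`
  have hkf : ∀ x : f.ker, p • x = 0 := fun x ↦ Subtype.ext (by
    rw [AddSubgroup.coe_nsmul, AddSubgroup.coe_zero, ← hgf, AddMonoidHom.mem_ker.mp x.2,
      map_zero])
  have hkg : ∀ y : g.ker, p • y = 0 := fun y ↦ Subtype.ext (by
    rw [AddSubgroup.coe_nsmul, AddSubgroup.coe_zero, ← hfg, AddMonoidHom.mem_ker.mp y.2,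
      map_zero])
  haveI mKf : Module (ZMod p) f.ker := AddCommGroup.zmodModule hkf
  haveI mKg : Module (ZMod p) g.ker := AddCommGroup.zmodModule hkg
  -- square orders and the two counting inequalities
  obtain ⟨i, hi⟩ := exists_natCard_eq_pow_two_mul p ι hι T hT b hb hbnd
  obtain ⟨i', hi'⟩ := exists_natCard_eq_pow_two_mul p ι hι T' hT' b' hb' hb'nd
  have h1 := natCard_ker_mul_card_le p ι hι b hbnd f g hgf fun x hx y ↦ by
    rw [← hadj, hx, map_zero, AddMonoidHom.zero_apply]
  have h2 := natCard_ker_mul_card_le p ι hι b' hb'nd g f hfg fun y hy x ↦ by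
    rw [← hadj', hy, map_zero, AddMonoidHom.zero_apply]
  refine ⟨finrank (ZMod p) f.ker, finrank (ZMod p) g.ker, (pow_finrank_eq_natCard p f.ker).symm,
    (pow_finrank_eq_natCard p g.ker).symm, ?_⟩
  rw [← pow_finrank_eq_natCard p f.ker, ← pow_finrank_eq_natCard p g.ker, hi, hi', ← pow_add,
    ← pow_add] at h1 h2
  have h1' := (Nat.pow_le_pow_iff_right hp.one_lt).mp h1
  have h2' := (Nat.pow_le_pow_iff_right hp.one_lt).mp h2
  rw [Nat.even_iff]
  omega

end Literature.GroupTheory.FiniteAbelian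

end
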